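import Summits.QuantumFields.YangMills.Theorems.Instrument.FreeLinkPolymerDefs
import Literature.MathematicalPhysics.QuantumFieldTheory.StrongCouplingClustering
import HarnessLib

/-!
# Instrument cell `ym-instrument`, crew (b): plaquette ∕ link geometry of `ℤ⁴` — two distinct plaquettes share at most one link; every plaquette has exactly four links and at
# least two FREE links of the comb gauge; hence NO (G1) polymer with fewer than three plaquettes and NO closed complex with fewer than five (typed census zeros)

QUESTIONS.md: Q-B1 (typed KP windows; the census zeros lift the vanishing order `n₀` of `KPCriterionSU2UnconditionalT2.kpCriterionSU2_of_t2`) ∕ Q-B2 (S2-SPEC v0.5.1 (G3): the head zeros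
`N_α(1) = N_α(2) = 0` of RADIUS-DERIVATION (7.2)); cell `run/shared/lean/pub/ym-instrument/`, HUMAN RULING D-0084 (2), director-ym R138.  HONEST FRAMING (page 1, binding).  WHAT IS
CERTIFIED HERE AND AT WHICH `(G, D, L, β)`: PURE COMBINATORICS of `ℤ⁴` (no group, no coupling, no volume): (§1) two distinct plaquettes of `ℤ^d` share at most one link
(`eq_of_mem_plaquetteEdges_of_ne`; proof adapted from `Summits/Ventures/YMGap/Thresholds/ZeroCouplingResampling.lean`, same statement, re-proved here because that module is not an
importable `Theorems` module); (§2) a plaquette of `ℤ^d` has exactly four links (`card_plaquetteEdges_eq_four`); (§3) in the `b = 2` comb gauge (`FreeLinkPolymerDefs.IsAxisLink ∕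
IsFreeLink`, S2-SPEC §1) the two parallel links of a plaquette are never both axis links (parity of the transverse coordinate), so every plaquette has two distinct FREE links
(`exists_two_freeLinks`); (§4) ★ CENSUS ZEROS, typed: `freePolymerCount f n = 0` for `n ≤ 2` (a (G1) polymer's plaquette has two free links, each in a second plaquette, and two
plaquettes sharing two links coincide) and `closedCount 4 n = 0` for `n ≤ 4` (every link of a closed complex lies in `≥ 2` of its plaquettes while two plaquettes share `≤ 1` link:
`2n ≤ Σ_l (deg l − 1) ≤ Σ_l C(deg l, 2) ≤ C(n, 2)`).  The paper's `N_α(3) = 0` (cube-corner parity) and `closedCount 4 5 = 0` are NOT typed here.  NOT a statement about any gauge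
theory, NOT a radius, NOT summit-bearing.  Grade (T).
-/

noncomputable section

open Finset
open Literature.MathematicalPhysics.QuantumLattice (ZdEdge ZdPlaquette plaquetteEdges plaquettesTouching)
open Literature.MathematicalPhysics.QuantumFieldTheory (mk_mem_plaquetteEdges_iff single_index_injective single_add_single_ne_zero add_single_ne_self)
open Literature.MathematicalPhysics.QuantumFieldTheory.Balaban1983to89.StrongCouplingKPWindow (links IsLinkConnected IsClosedComplex rootLink closedCount)
open Literature.Probability.LatticeModels (Site)
open Summit.QuantumFields.YangMills.Theorems.Instrument.AdmissibleLinkComplexCount (IsAdmConnected)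
open Summit.QuantumFields.YangMills.Theorems.Instrument.ClosedComplexExploration (atLink)
open Summit.QuantumFields.YangMills.Theorems.Instrument.ClosedComplexTailBound (AdmClosed closedCount_eq_admClosedCount)
open Summit.QuantumFields.YangMills.Theorems.Instrument.FreeLinkPolymerDefs (IsAxisLink IsFreeLink freePolymerCount)

namespace Summit.QuantumFields.YangMills.Theorems.Instrument.PlaquetteLinkGeometry

/-! ## §1 Two distinct plaquettes share at most one link (adapted from `Ventures/YMGap/Thresholds/ZeroCouplingResampling`) -/

section Shared

variable {d : ℕ}

/-- `x + e_m + e_n ≠ x` in `ℤ^d`. [folklore] -/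
theorem add_single_add_single_ne (x : Site d) (m n : Fin d) : x + Pi.single m 1 + Pi.single n 1 ≠ x := by
  intro h
  rw [add_assoc] at h
  exact single_add_single_ne_zero m n (add_eq_left.mp h)

/-- Offsets: if `x − y ∈ {0, ± e_m} ∩ {0, ± e_n}` with `m ≠ n` then `x = y`. [folklore] -/
theorem eq_of_offsets {x y : Site d} {m n : Fin d} (hmn : m ≠ n)
    (h1 : x = y ∨ x = y + Pi.single m 1 ∨ y = x + Pi.single m 1)
    (h2 : x = y ∨ x = y + Pi.single n 1 ∨ y = x + Pi.single n 1) : x = y := by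
  rcases h1 with h1 | h1 | h1
  · exact h1
  · rcases h2 with h2 | h2 | h2
    · exact h2
    · exact absurd (single_index_injective (add_left_cancel (h1.symm.trans h2))) hmn
    · exfalso; rw [h1] at h2; exact add_single_add_single_ne y m n h2.symm
  · rcases h2 with h2 | h2 | h2
    · exact h2
    · exfalso; rw [h1] at h2; exact add_single_add_single_ne x m n h2.symm
    · exact absurd (single_index_injective (add_left_cancel (h1.symm.trans h2))) hmn

/-- From `z ∈ {x, x + s}` and `z ∈ {y, y + s}` conclude `x − y ∈ {0, ± s}`. [folklore] -/
theorem offsets_of_mem {z x y s : Site d} (hp : z = x ∨ z = x + s) (hq : z = y ∨ z = y + s) :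
    x = y ∨ x = y + s ∨ y = x + s := by
  rcases hp with rfl | rfl <;> rcases hq with h | h
  · exact Or.inl h
  · exact Or.inr (Or.inl h)
  · exact Or.inr (Or.inr h.symm)
  · exact Or.inl (add_right_cancel h)

/-- Two PARALLEL edges `{z₁, z₂} = {x, x + e_m} = {y, y + e_n}` (ordered pairs of distinct sites) force `x = y` and `m = n`. [folklore] -/
theorem eq_of_parallel {z₁ z₂ x y : Site d} {m n : Fin d}
    (hp : z₁ = x ∧ z₂ = x + Pi.single m 1 ∨ z₁ = x + Pi.single m 1 ∧ z₂ = x)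
    (hq : z₁ = y ∧ z₂ = y + Pi.single n 1 ∨ z₁ = y + Pi.single n 1 ∧ z₂ = y) : x = y ∧ m = n := by
  rcases hp with ⟨rfl, rfl⟩ | ⟨rfl, rfl⟩ <;> rcases hq with ⟨h1, h2⟩ | ⟨h1, h2⟩
  · subst h1; exact ⟨rfl, single_index_injective (add_left_cancel h2)⟩
  · exfalso; rw [h1] at h2; exact add_single_add_single_ne _ n m h2
  · exfalso; rw [h2] at h1; exact add_single_add_single_ne _ n m h1
  · subst h2; exact ⟨rfl, single_index_injective (add_left_cancel h1)⟩

/-- ★ **Two distinct plaquettes of `ℤ^d` share at most one link**: if two DISTINCT edges `e₁ ≠ e₂` both lie in the plaquettes `p` and `q`, then `p = q` (any two of its four links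
determine a plaquette).  Adapted from `Summits/Ventures/YMGap/Thresholds/ZeroCouplingResampling.lean` (`eq_of_mem_plaquetteEdges_of_ne`). [folklore] -/
theorem eq_of_mem_plaquetteEdges_of_ne {p q : ZdPlaquette d} {e₁ e₂ : ZdEdge d} (hne : e₁ ≠ e₂)
    (h1p : e₁ ∈ plaquetteEdges p) (h2p : e₂ ∈ plaquetteEdges p) (h1q : e₁ ∈ plaquetteEdges q) (h2q : e₂ ∈ plaquetteEdges q) : p = q := by
  obtain ⟨x, ⟨⟨i, j⟩, hij⟩⟩ := p
  obtain ⟨y, ⟨⟨k, l⟩, hkl⟩⟩ := q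
  obtain ⟨z₁, m₁⟩ := e₁
  obtain ⟨z₂, m₂⟩ := e₂
  have hij' : (i : ℕ) < j := hij
  have hkl' : (k : ℕ) < l := hkl
  rw [mk_mem_plaquetteEdges_iff] at h1p h2p h1q h2q
  simp only at h1p h2p h1q h2q
  suffices h : x = y ∧ i = k ∧ j = l by
    obtain ⟨rfl, rfl, rfl⟩ := h; rfl
  have hz : m₁ = m₂ → z₁ ≠ z₂ := by rintro rfl h; exact hne (by rw [h])
  rcases h1p with ⟨rfl, hz1p⟩ | ⟨rfl, hz1p⟩ <;> rcases h2p with ⟨h2, hz2p⟩ | ⟨h2, hz2p⟩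
  · -- both edges in direction `i` of `p`: `{z₁, z₂} = {x, x + e_j}`
    have hz12 := hz h2
    subst h2
    have hpar : z₁ = x ∧ z₂ = x + Pi.single j 1 ∨ z₁ = x + Pi.single j 1 ∧ z₂ = x := by
      rcases hz1p with rfl | rfl <;> rcases hz2p with rfl | rfl
      · exact absurd rfl hz12
      · exact Or.inl ⟨rfl, rfl⟩
      · exact Or.inr ⟨rfl, rfl⟩
      · exact absurd rfl hz12
    rcases h1q with ⟨h1, hz1q⟩ | ⟨h1, hz1q⟩ <;> rcases h2q with ⟨h2', hz2q⟩ | ⟨h2', hz2q⟩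
    · subst h1
      have hqar : z₁ = y ∧ z₂ = y + Pi.single l 1 ∨ z₁ = y + Pi.single l 1 ∧ z₂ = y := by
        rcases hz1q with h | h <;> rcases hz2q with h' | h'
        · exact absurd (h.trans h'.symm) hz12
        · exact Or.inl ⟨h, h'⟩
        · exact Or.inr ⟨h, h'⟩
        · exact absurd (h.trans h'.symm) hz12
      obtain ⟨hxy, hjl⟩ := eq_of_parallel hpar hqar
      exact ⟨hxy, rfl, hjl⟩
    · exfalso; subst h1; subst h2'; omega
    · exfalso; subst h1; subst h2'; omega
    · subst h1
      have hqar : z₁ = y ∧ z₂ = y + Pi.single k 1 ∨ z₁ = y + Pi.single k 1 ∧ z₂ = y := by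
        rcases hz1q with h | h <;> rcases hz2q with h' | h'
        · exact absurd (h.trans h'.symm) hz12
        · exact Or.inr ⟨h, h'⟩
        · exact Or.inl ⟨h, h'⟩
        · exact absurd (h.trans h'.symm) hz12
      obtain ⟨-, hjk⟩ := eq_of_parallel hpar hqar
      exfalso; subst hjk; omega
  · -- `e₁` in direction `i`, `e₂` in direction `j`
    subst h2
    rcases h1q with ⟨h1, hz1q⟩ | ⟨h1, hz1q⟩ <;> rcases h2q with ⟨h2', hz2q⟩ | ⟨h2', hz2q⟩
    · exfalso; subst h1; subst h2'; omega
    · subst h1; subst h2'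
      have o1 := offsets_of_mem hz1p hz1q
      have o2 := offsets_of_mem (hz2p.elim Or.inr Or.inl) (hz2q.elim Or.inr Or.inl)
      exact ⟨eq_of_offsets (fun h => by subst h; omega) o1 o2, rfl, rfl⟩
    · exfalso; subst h1; subst h2'; omega
    · exfalso; subst h1; subst h2'; omega
  · -- `e₁` in direction `j`, `e₂` in direction `i`
    subst h2
    rcases h1q with ⟨h1, hz1q⟩ | ⟨h1, hz1q⟩ <;> rcases h2q with ⟨h2', hz2q⟩ | ⟨h2', hz2q⟩
    · exfalso; subst h1; subst h2'; omega
    · exfalso; subst h1; subst h2'; omega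
    · subst h1; subst h2'
      have o1 := offsets_of_mem (hz1p.elim Or.inr Or.inl) (hz1q.elim Or.inr Or.inl)
      have o2 := offsets_of_mem hz2p hz2q
      exact ⟨eq_of_offsets (fun h => by subst h; omega) o1 o2, rfl, rfl⟩
    · exfalso; subst h1; subst h2'; omega
  · -- both edges in direction `j` of `p`: `{z₁, z₂} = {x + e_i, x}`
    have hz12 := hz h2
    subst h2
    have hpar : z₁ = x ∧ z₂ = x + Pi.single i 1 ∨ z₁ = x + Pi.single i 1 ∧ z₂ = x := by
      rcases hz1p with rfl | rfl <;> rcases hz2p with rfl | rfl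
      · exact absurd rfl hz12
      · exact Or.inr ⟨rfl, rfl⟩
      · exact Or.inl ⟨rfl, rfl⟩
      · exact absurd rfl hz12
    rcases h1q with ⟨h1, hz1q⟩ | ⟨h1, hz1q⟩ <;> rcases h2q with ⟨h2', hz2q⟩ | ⟨h2', hz2q⟩
    · subst h1
      have hqar : z₁ = y ∧ z₂ = y + Pi.single l 1 ∨ z₁ = y + Pi.single l 1 ∧ z₂ = y := by
        rcases hz1q with h | h <;> rcases hz2q with h' | h'
        · exact absurd (h.trans h'.symm) hz12
        · exact Or.inl ⟨h, h'⟩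
        · exact Or.inr ⟨h, h'⟩
        · exact absurd (h.trans h'.symm) hz12
      obtain ⟨-, hil⟩ := eq_of_parallel hpar hqar
      exfalso; subst hil; omega
    · exfalso; subst h1; subst h2'; omega
    · exfalso; subst h1; subst h2'; omega
    · subst h1
      have hqar : z₁ = y ∧ z₂ = y + Pi.single k 1 ∨ z₁ = y + Pi.single k 1 ∧ z₂ = y := by
        rcases hz1q with h | h <;> rcases hz2q with h' | h'
        · exact absurd (h.trans h'.symm) hz12
        · exact Or.inr ⟨h, h'⟩
        · exact Or.inl ⟨h, h'⟩
        · exact absurd (h.trans h'.symm) hz12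
      obtain ⟨hxy, hik⟩ := eq_of_parallel hpar hqar
      exact ⟨hxy, hik, rfl⟩

/-- Two distinct plaquettes share at most one link (cardinality form). [folklore] -/
theorem card_inter_plaquetteEdges_le_one {p q : ZdPlaquette d} (hpq : p ≠ q) : (plaquetteEdges p ∩ plaquetteEdges q).card ≤ 1 := by
  rw [Finset.card_le_one]
  intro e₁ h1 e₂ h2
  by_contra hne
  rw [Finset.mem_inter] at h1 h2
  exact hpq (eq_of_mem_plaquetteEdges_of_ne hne h1.1 h2.1 h1.2 h2.2)

/-! ## §2 A plaquette has exactly four links -/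

/-- The four links of a plaquette are pairwise distinct: `#plaquetteEdges p = 4`. [folklore] -/
theorem card_plaquetteEdges_eq_four (p : ZdPlaquette d) : (plaquetteEdges p).card = 4 := by
  obtain ⟨x, ⟨⟨i, j⟩, hij⟩⟩ := p
  have hij' : i ≠ j := ne_of_lt hij
  have h1 : (x, i) ≠ (x + Pi.single i 1, j) := fun h => hij' (Prod.mk.inj h).2
  have h2 : (x, i) ≠ (x + Pi.single j 1, i) := fun h => add_single_ne_self x j (Prod.mk.inj h).1.symm
  have h3 : ((x, i) : ZdEdge d) ≠ (x, j) := fun h => hij' (Prod.mk.inj h).2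
  have h4 : (x + Pi.single i 1, j) ≠ (x + Pi.single j 1, i) := fun h => hij' (Prod.mk.inj h).2.symm
  have h5 : (x + Pi.single i 1, j) ≠ (x, j) := fun h => add_single_ne_self x i (Prod.mk.inj h).1
  have h6 : (x + Pi.single j 1, i) ≠ (x, j) := fun h => hij' (Prod.mk.inj h).2
  simp only [plaquetteEdges]
  rw [card_insert_of_notMem, card_insert_of_notMem, card_insert_of_notMem, card_singleton]
  · simp only [mem_singleton]; exact h6
  · simp only [mem_insert, mem_singleton, not_or]; exact ⟨h4, h5⟩
  · simp only [mem_insert, mem_singleton, not_or]; exact ⟨h1, h2, h3⟩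

end Shared

/-! ## §3 Comb-gauge parity: the two parallel links of a plaquette are never both axis links -/

/-- The two links of direction `i` of the plaquette `(x; i, j)` — `(x, i)` and `(x + e_j, i)` — are not both axis links: their `j`-coordinates differ by one. [folklore] -/
theorem not_isAxisLink_both (x : Site 4) {i j : Fin 4} (hij : i ≠ j) : ¬ (IsAxisLink (x, i) ∧ IsAxisLink (x + Pi.single j 1, i)) := by
  rintro ⟨h1, h2⟩
  have e1 : Even (x j) := h1 j (Ne.symm hij)
  have e2 : Even (x j + 1) := by
    have := h2 j (Ne.symm hij)
    simpa [Pi.add_apply, Pi.single_eq_same] using this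
  obtain ⟨a, ha⟩ := e1
  obtain ⟨b, hb⟩ := e2
  omega

/-- ★ Every plaquette of `ℤ⁴` has two distinct FREE links of the comb gauge (one in each of its two directions). [folklore] -/
theorem exists_two_freeLinks (p : ZdPlaquette 4) : ∃ g₁ ∈ plaquetteEdges p, ∃ g₂ ∈ plaquetteEdges p, g₁ ≠ g₂ ∧ IsFreeLink g₁ ∧ IsFreeLink g₂ := by
  obtain ⟨x, ⟨⟨i, j⟩, hij⟩⟩ := p
  have hij' : i ≠ j := ne_of_lt hij
  have hmem : ∀ e : ZdEdge 4, e = (x, i) ∨ e = (x + Pi.single i 1, j) ∨ e = (x + Pi.single j 1, i) ∨ e = (x, j) →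
      e ∈ plaquetteEdges ((x, ⟨(i, j), hij⟩) : ZdPlaquette 4) := fun e he => by
    simp only [plaquetteEdges, mem_insert, mem_singleton]; exact he
  -- a free link in direction `i` and one in direction `j`
  have hi : ∃ g, g ∈ plaquetteEdges ((x, ⟨(i, j), hij⟩) : ZdPlaquette 4) ∧ g.2 = i ∧ IsFreeLink g := by
    by_cases h : IsAxisLink (x, i)
    · exact ⟨(x + Pi.single j 1, i), hmem _ (Or.inr (Or.inr (Or.inl rfl))), rfl, fun h' => not_isAxisLink_both x hij' ⟨h, h'⟩⟩
    · exact ⟨(x, i), hmem _ (Or.inl rfl), rfl, h⟩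
  have hj : ∃ g, g ∈ plaquetteEdges ((x, ⟨(i, j), hij⟩) : ZdPlaquette 4) ∧ g.2 = j ∧ IsFreeLink g := by
    by_cases h : IsAxisLink (x, j)
    · exact ⟨(x + Pi.single i 1, j), hmem _ (Or.inr (Or.inl rfl)), rfl, fun h' => not_isAxisLink_both x (Ne.symm hij') ⟨h, h'⟩⟩
    · exact ⟨(x, j), hmem _ (Or.inr (Or.inr (Or.inr rfl))), rfl, h⟩
  obtain ⟨g₁, hg₁, hd₁, hf₁⟩ := hi
  obtain ⟨g₂, hg₂, hd₂, hf₂⟩ := hj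
  exact ⟨g₁, hg₁, g₂, hg₂, fun h => hij' (hd₁.symm.trans (h ▸ hd₂)), hf₁, hf₂⟩

/-! ## §4 ★ Census zeros, typed -/

/-- ★ **No (G1) polymer with fewer than three plaquettes**: `freePolymerCount f n = 0` for `n ≤ 2` and every link `f` (a plaquette of an admissible set has two distinct free links,
each in a second plaquette of the set; two plaquettes sharing two links coincide). [folklore] -/
theorem freePolymerCount_eq_zero_of_le_two (f : ZdEdge 4) {n : ℕ} (hn : n ≤ 2) : freePolymerCount f n = 0 := by
  unfold freePolymerCount
  haveI : IsEmpty {X : Finset (ZdPlaquette 4) // X.card = n ∧ f ∈ links X ∧ IsAdmConnected IsFreeLink X ∧ AdmClosed IsFreeLink X} :=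
    ⟨fun ⟨X, hcard, hf, _, hcl⟩ => by
      -- a plaquette `p ∈ X` and its two free links
      obtain ⟨p, hpX, -⟩ := mem_biUnion.1 hf
      obtain ⟨g₁, hg₁, g₂, hg₂, hne, hf₁, hf₂⟩ := exists_two_freeLinks p
      have two : ∀ g ∈ plaquetteEdges p, IsFreeLink g → 2 ≤ (atLink X g).card := fun g hg hfree =>
        hcl g (mem_biUnion.2 ⟨p, hpX, hg⟩) hfree
      -- each free link of `p` lies in a second plaquette of `X`
      have second : ∀ g ∈ plaquetteEdges p, IsFreeLink g → ∃ q ∈ X, q ≠ p ∧ g ∈ plaquetteEdges q := fun g hg hfree => by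
        obtain ⟨q, hq, hqp⟩ := Finset.exists_mem_ne (lt_of_lt_of_le one_lt_two (two g hg hfree)) p
        exact ⟨q, (mem_filter.1 hq).1, hqp, (mem_filter.1 hq).2⟩
      obtain ⟨q₁, hq₁X, hq₁p, hg₁q⟩ := second g₁ hg₁ hf₁
      obtain ⟨q₂, hq₂X, hq₂p, hg₂q⟩ := second g₂ hg₂ hf₂
      -- `q₁ ≠ q₂` (else `q₁` shares two links with `p`), so `p, q₁, q₂` are three distinct members of `X`
      have hq₁₂ : q₁ ≠ q₂ := fun h => hq₁p (eq_of_mem_plaquetteEdges_of_ne hne hg₁q (h ▸ hg₂q) hg₁ hg₂)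
      have h3 : ({p, q₁, q₂} : Finset (ZdPlaquette 4)).card = 3 := by
        rw [card_insert_of_notMem, card_insert_of_notMem, card_singleton]
        · simpa using hq₁₂
        · simp only [mem_insert, mem_singleton, not_or]; exact ⟨hq₁p.symm, hq₂p.symm⟩
      have hsub : ({p, q₁, q₂} : Finset (ZdPlaquette 4)) ⊆ X := by
        intro r hr
        simp only [mem_insert, mem_singleton] at hr
        rcases hr with rfl | rfl | rfl
        · exact hpX
        · exact hq₁X
        · exact hq₂X
      have := card_le_card hsub
      omega⟩
  exact Nat.card_of_isEmpty

/-- The double count behind the closed-complex zeros: for a finite plaquette set `X`, `Σ_{l ∈ links X} C(deg_X l, 2) ≤ C(#X, 2)` — a pair of distinct plaquettes of `X` is counted at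
most once, at their (at most one) common link. [folklore] -/
theorem sum_choose_two_atLink_le (X : Finset (ZdPlaquette 4)) : ∑ l ∈ links X, ((atLink X l).card.choose 2) ≤ X.card.choose 2 := by
  classical
  -- `C(deg l, 2) = #(pairs of X through l)`; the map (l, pair) ↦ pair is injective into the pairs of `X`
  have hrw : ∀ l ∈ links X, (atLink X l).card.choose 2 = ((atLink X l).powersetCard 2).card := fun l _ => (card_powersetCard 2 _).symm
  rw [sum_congr rfl hrw, ← card_biUnion]
  · rw [← card_powersetCard 2 X]
    refine card_le_card fun s hs => ?_
    obtain ⟨l, -, hsl⟩ := mem_biUnion.1 hs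
    exact powersetCard_mono (filter_subset _ _) hsl
  · -- pairwise disjoint: a 2-set of plaquettes lies in `powersetCard 2 (atLink X l)` for at most one `l`
    intro l₁ _ l₂ _ hne
    rw [Function.onFun, disjoint_left]
    intro s hs₁ hs₂
    rw [mem_powersetCard] at hs₁ hs₂
    obtain ⟨hs₁, hcard⟩ := hs₁
    obtain ⟨hs₂, -⟩ := hs₂
    obtain ⟨p, q, hpq, rfl⟩ := card_eq_two.1 hcard
    have hp₁ := (mem_filter.1 (hs₁ (mem_insert_self _ _))).2
    have hq₁ := (mem_filter.1 (hs₁ (mem_insert_of_mem (mem_singleton_self _)))).2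
    have hp₂ := (mem_filter.1 (hs₂ (mem_insert_self _ _))).2
    have hq₂ := (mem_filter.1 (hs₂ (mem_insert_of_mem (mem_singleton_self _)))).2
    exact hpq (eq_of_mem_plaquetteEdges_of_ne hne hp₁ hp₂ hq₁ hq₂)

/-- Degree sum: `Σ_{l ∈ links X} deg_X l = 4·#X` (every plaquette has exactly four links). [folklore] -/
theorem sum_card_atLink_eq (X : Finset (ZdPlaquette 4)) : ∑ l ∈ links X, (atLink X l).card = 4 * X.card := by
  classical
  calc ∑ l ∈ links X, (atLink X l).card = ∑ l ∈ links X, ∑ p ∈ X, (if l ∈ plaquetteEdges p then 1 else 0) := by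
        refine sum_congr rfl fun l _ => ?_
        rw [card_filter]
    _ = ∑ p ∈ X, ∑ l ∈ links X, (if l ∈ plaquetteEdges p then 1 else 0) := sum_comm
    _ = ∑ p ∈ X, (plaquetteEdges p).card := by
        refine sum_congr rfl fun p hp => ?_
        rw [← card_filter]
        congr 1
        ext l
        simp only [mem_filter]
        exact ⟨fun h => h.2, fun h => ⟨mem_biUnion.2 ⟨p, hp, h⟩, h⟩⟩
    _ = ∑ _p ∈ X, 4 := sum_congr rfl fun p _ => card_plaquetteEdges_eq_four p
    _ = 4 * X.card := by rw [sum_const, smul_eq_mul, mul_comm]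

/-- ★ **No closed complex with fewer than five plaquettes**: `closedCount 4 n = 0` for `n ≤ 4` (`2n ≤ Σ_l (deg l − 1) ≤ Σ_l C(deg l, 2) ≤ C(n, 2)` forces `n ≥ 5`). [folklore] -/
theorem closedCount_four_eq_zero_of_le_four {n : ℕ} (hn : n ≤ 4) : closedCount 4 n = 0 := by
  unfold closedCount
  haveI : IsEmpty {X : Finset (ZdPlaquette 4) // X.card = n ∧ rootLink 4 ∈ links X ∧ IsLinkConnected X ∧ IsClosedComplex X} :=
    ⟨fun ⟨X, hcard, hroot, _, hcl⟩ => by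
      have hdeg : ∀ l ∈ links X, 2 ≤ (atLink X l).card := fun l hl => hcl l hl
      -- `deg ≤ 1 + C(deg, 2)` when `deg ≥ 2`... precisely `deg ≤ C(deg,2) + 1` and `2·(deg − 1) ≤ 2·C(deg,2)`; we use `deg ≤ 2·C(deg, 2)` for `deg ≥ 2`
      have hle : ∀ l ∈ links X, (atLink X l).card ≤ 2 * ((atLink X l).card.choose 2) := fun l hl => by
        have h2 := hdeg l hl
        rw [Nat.choose_two_right]
        have : 2 * ((atLink X l).card * ((atLink X l).card - 1) / 2) = (atLink X l).card * ((atLink X l).card - 1) :=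
          Nat.two_mul_div_two_of_even (Nat.even_mul_pred_self _)
        rw [this]
        calc (atLink X l).card = (atLink X l).card * 1 := (mul_one _).symm
          _ ≤ (atLink X l).card * ((atLink X l).card - 1) := Nat.mul_le_mul_left _ (by omega)
      have h1 : 4 * X.card ≤ 2 * X.card.choose 2 :=
        calc 4 * X.card = ∑ l ∈ links X, (atLink X l).card := (sum_card_atLink_eq X).symm
          _ ≤ ∑ l ∈ links X, 2 * ((atLink X l).card.choose 2) := sum_le_sum hle
          _ = 2 * ∑ l ∈ links X, ((atLink X l).card.choose 2) := by rw [mul_sum]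
          _ ≤ 2 * X.card.choose 2 := Nat.mul_le_mul_left 2 (sum_choose_two_atLink_le X)
      rw [hcard, Nat.choose_two_right] at h1
      -- `X` is nonempty (the root link is a link of `X`), so `n ≥ 1`; then `4n ≤ n(n−1)` forces `n ≥ 5`
      have hn1 : 1 ≤ n := by
        obtain ⟨p, hp, -⟩ := mem_biUnion.1 hroot
        rw [← hcard]; exact card_pos.2 ⟨p, hp⟩
      interval_cases n <;> omega⟩
  exact Nat.card_of_isEmpty

end Summit.QuantumFields.YangMills.Theorems.Instrument.PlaquetteLinkGeometry

end
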